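import Literature.MathematicalPhysics.KineticTheory.TrigPolySymbol
import HarnessLib

/-!
# Sup bounds for symbolic trigonometric polynomials from their `δ`-classes

`Literature/MathematicalPhysics/KineticTheory/` — the pointwise consequences of `TrigPoly.InClass`
(De Roeck–Huveneers "`g ∼ δ^{-p}`") used in §5.6 of W. De Roeck, F. Huveneers, CPAM 68 (2015),
arXiv:1305.5127: with `W = 1 + ‖ω‖`,

* `InClass.exists_bound_ev`: `|ev F(q, ω)| ≤ C δ^{-p} W^M`;
* `InClass.exists_bound_partialQ`: `|∂_{q_x} ev F| ≤ C δ^{-p} W^M` (with a mode bound);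
* `InClass.exists_bound_partialP`: `|∂_{ω_x} ev F| ≤ C δ^{-(p+1)} W^M`;

uniformly in `δ ∈ (0, 1]`, `q`, `x`, with `C`, `M` depending on `F` only. All proved.
-/

noncomputable section

open Function Set Finset Filter
open scoped ContDiff BigOperators Topology

namespace Literature.MathematicalPhysics.KineticTheory.HeatConduction

open Literature.Analysis.Calculus Literature.Analysis.Calculus.IsDeltaSymbol

variable {m : ℕ}

/-- Powers of the weight `W = 1 + ‖ω‖ ≥ 1` are monotone in the exponent. [folklore] -/
theorem weight_pow_mono (w : Fin m → ℝ) {M M' : ℕ} (h : M ≤ M') : (1 + ‖w‖) ^ M ≤ (1 + ‖w‖) ^ M' :=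
  pow_le_pow_right₀ (one_le_weight w) h

namespace TrigTerm

/-- **A term of class `p` is `O(δ^{-p} W^M)`.** [cite: DeRoeckHuveneers2015, §5.6] -/
theorem InClass.exists_bound_ev {t : TrigTerm m} {p : ℕ} (h : t.InClass p) :
    ∃ C : ℝ, ∃ M : ℕ, 0 ≤ C ∧ ∀ δ : ℝ, 0 < δ → δ ≤ 1 → ∀ z : PhaseSpace m, |t.ev δ z| ≤ C / δ ^ p * (1 + ‖z.2‖) ^ M := by
  obtain ⟨Ca, Ma, hCa, ha⟩ := h.1.norm_le
  obtain ⟨Cb, Mb, hCb, hb⟩ := h.2.norm_le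
  refine ⟨Ca + Cb, max Ma Mb, by positivity, fun δ hδ hδ1 z => ?_⟩
  have h1 := ha δ hδ hδ1 z.2
  have h2 := hb δ hδ hδ1 z.2
  rw [Real.norm_eq_abs] at h1 h2
  have hW := one_le_weight z.2
  have hWa : (1 + ‖z.2‖) ^ Ma ≤ (1 + ‖z.2‖) ^ max Ma Mb := weight_pow_mono z.2 (le_max_left _ _)
  have hWb : (1 + ‖z.2‖) ^ Mb ≤ (1 + ‖z.2‖) ^ max Ma Mb := weight_pow_mono z.2 (le_max_right _ _)
  have hd : 0 ≤ 1 / δ ^ p := by positivity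
  unfold TrigTerm.ev
  calc |t.cosCoeff δ z.2 * Real.cos (modePhase t.mode z.1) + t.sinCoeff δ z.2 * Real.sin (modePhase t.mode z.1)|
      ≤ |t.cosCoeff δ z.2| * |Real.cos (modePhase t.mode z.1)| + |t.sinCoeff δ z.2| * |Real.sin (modePhase t.mode z.1)| := by
        refine (abs_add_le _ _).trans ?_; rw [abs_mul, abs_mul]
    _ ≤ |t.cosCoeff δ z.2| * 1 + |t.sinCoeff δ z.2| * 1 := by
        gcongr
        · exact Real.abs_cos_le_one _
        · exact Real.abs_sin_le_one _
    _ ≤ Ca / δ ^ p * (1 + ‖z.2‖) ^ Ma + Cb / δ ^ p * (1 + ‖z.2‖) ^ Mb := by rw [mul_one, mul_one]; exact add_le_add h1 h2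
    _ ≤ Ca / δ ^ p * (1 + ‖z.2‖) ^ max Ma Mb + Cb / δ ^ p * (1 + ‖z.2‖) ^ max Ma Mb := by
        gcongr
    _ = (Ca + Cb) / δ ^ p * (1 + ‖z.2‖) ^ max Ma Mb := by ring

/-- **`∂_{q_x}` of a term of class `p` with `|k|_∞ ≤ B` is `O(δ^{-p} W^M)`.** [cite: DeRoeckHuveneers2015, §5.6] -/
theorem InClass.exists_bound_partialQ {t : TrigTerm m} {p : ℕ} (h : t.InClass p) {B : ℕ} (hB : ∀ y, |t.mode y| ≤ B) :
    ∃ C : ℝ, ∃ M : ℕ, 0 ≤ C ∧ ∀ δ : ℝ, 0 < δ → δ ≤ 1 → ∀ (x : Fin m) (z : PhaseSpace m),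
      |partialQ x (t.ev δ) z| ≤ C / δ ^ p * (1 + ‖z.2‖) ^ M := by
  obtain ⟨Ca, Ma, hCa, ha⟩ := h.1.norm_le
  obtain ⟨Cb, Mb, hCb, hb⟩ := h.2.norm_le
  refine ⟨B * (Ca + Cb), max Ma Mb, by positivity, fun δ hδ hδ1 x z => ?_⟩
  have h1 := ha δ hδ hδ1 z.2
  have h2 := hb δ hδ hδ1 z.2
  rw [Real.norm_eq_abs] at h1 h2
  have hWa : (1 + ‖z.2‖) ^ Ma ≤ (1 + ‖z.2‖) ^ max Ma Mb := weight_pow_mono z.2 (le_max_left _ _)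
  have hWb : (1 + ‖z.2‖) ^ Mb ≤ (1 + ‖z.2‖) ^ max Ma Mb := weight_pow_mono z.2 (le_max_right _ _)
  have hk : |(t.mode x : ℝ)| ≤ B := by exact_mod_cast hB x
  rw [TrigTerm.partialQ_ev, abs_mul]
  calc |(t.mode x : ℝ)| * |t.sinCoeff δ z.2 * Real.cos (modePhase t.mode z.1) - t.cosCoeff δ z.2 * Real.sin (modePhase t.mode z.1)|
      ≤ B * (|t.sinCoeff δ z.2| * |Real.cos (modePhase t.mode z.1)| + |t.cosCoeff δ z.2| * |Real.sin (modePhase t.mode z.1)|) := by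
        gcongr
        refine (abs_sub _ _).trans ?_; rw [abs_mul, abs_mul]
    _ ≤ B * (|t.sinCoeff δ z.2| * 1 + |t.cosCoeff δ z.2| * 1) := by
        gcongr
        · exact Real.abs_cos_le_one _
        · exact Real.abs_sin_le_one _
    _ ≤ B * (Cb / δ ^ p * (1 + ‖z.2‖) ^ max Ma Mb + Ca / δ ^ p * (1 + ‖z.2‖) ^ max Ma Mb) := by
        rw [mul_one, mul_one]
        gcongr
        · exact h2.trans (by gcongr)
        · exact h1.trans (by gcongr)
    _ = B * (Ca + Cb) / δ ^ p * (1 + ‖z.2‖) ^ max Ma Mb := by ring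

/-- **`∂_{ω_x}` of a term of class `p` is `O(δ^{-(p+1)} W^M)`.** [cite: DeRoeckHuveneers2015, §5.6] -/
theorem InClass.exists_bound_partialP {t : TrigTerm m} {p : ℕ} (h : t.InClass p) :
    ∃ C : ℝ, ∃ M : ℕ, 0 ≤ C ∧ ∀ δ : ℝ, 0 < δ → δ ≤ 1 → ∀ (x : Fin m) (z : PhaseSpace m),
      |partialP x (t.ev δ) z| ≤ C / δ ^ (p + 1) * (1 + ‖z.2‖) ^ M := by
  obtain ⟨Ca, Ma, hCa, ha⟩ := h.1.norm_fderiv_apply_le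
  obtain ⟨Cb, Mb, hCb, hb⟩ := h.2.norm_fderiv_apply_le
  refine ⟨Ca + Cb, max Ma Mb, by positivity, fun δ hδ hδ1 x z => ?_⟩
  have hs : ‖(Pi.single x (1 : ℝ) : Fin m → ℝ)‖ ≤ 1 := by
    refine (pi_norm_le_iff_of_nonneg zero_le_one).2 fun y => ?_
    by_cases hy : y = x
    · subst hy; simp
    · simp [hy]
  have h1 := ha δ hδ hδ1 z.2 (Pi.single x 1)
  have h2 := hb δ hδ hδ1 z.2 (Pi.single x 1)
  rw [Real.norm_eq_abs] at h1 h2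
  have hWa : (1 + ‖z.2‖) ^ Ma ≤ (1 + ‖z.2‖) ^ max Ma Mb := weight_pow_mono z.2 (le_max_left _ _)
  have hWb : (1 + ‖z.2‖) ^ Mb ≤ (1 + ‖z.2‖) ^ max Ma Mb := weight_pow_mono z.2 (le_max_right _ _)
  have hda : 0 ≤ Ca / δ ^ (p + 1) * (1 + ‖z.2‖) ^ Ma := by positivity
  have hdb : 0 ≤ Cb / δ ^ (p + 1) * (1 + ‖z.2‖) ^ Mb := by positivity
  have h1' : |fderiv ℝ (t.cosCoeff δ) z.2 (Pi.single x 1)| ≤ Ca / δ ^ (p + 1) * (1 + ‖z.2‖) ^ max Ma Mb :=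
    h1.trans ((mul_le_of_le_one_left hda hs).trans (by gcongr))
  have h2' : |fderiv ℝ (t.sinCoeff δ) z.2 (Pi.single x 1)| ≤ Cb / δ ^ (p + 1) * (1 + ‖z.2‖) ^ max Ma Mb :=
    h2.trans ((mul_le_of_le_one_left hdb hs).trans (by gcongr))
  have hsm : t.SmoothAt δ := h.smoothAt hδ hδ1
  rw [TrigTerm.partialP_ev t hsm.differentiable.1 hsm.differentiable.2]
  calc |fderiv ℝ (t.cosCoeff δ) z.2 (Pi.single x 1) * Real.cos (modePhase t.mode z.1) +
        fderiv ℝ (t.sinCoeff δ) z.2 (Pi.single x 1) * Real.sin (modePhase t.mode z.1)|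
      ≤ |fderiv ℝ (t.cosCoeff δ) z.2 (Pi.single x 1)| * |Real.cos (modePhase t.mode z.1)| +
          |fderiv ℝ (t.sinCoeff δ) z.2 (Pi.single x 1)| * |Real.sin (modePhase t.mode z.1)| := by
        refine (abs_add_le _ _).trans ?_; rw [abs_mul, abs_mul]
    _ ≤ |fderiv ℝ (t.cosCoeff δ) z.2 (Pi.single x 1)| * 1 + |fderiv ℝ (t.sinCoeff δ) z.2 (Pi.single x 1)| * 1 := by
        gcongr
        · exact Real.abs_cos_le_one _
        · exact Real.abs_sin_le_one _
    _ ≤ Ca / δ ^ (p + 1) * (1 + ‖z.2‖) ^ max Ma Mb + Cb / δ ^ (p + 1) * (1 + ‖z.2‖) ^ max Ma Mb := by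
        rw [mul_one, mul_one]; exact add_le_add h1' h2'
    _ = (Ca + Cb) / δ ^ (p + 1) * (1 + ‖z.2‖) ^ max Ma Mb := by ring

end TrigTerm

namespace TrigPoly

variable {F : TrigPoly m} {p : ℕ}

/-- **A polynomial of class `p` is `O(δ^{-p} W^M)`**, uniformly in `q` and `δ ∈ (0,1]`. [cite: DeRoeckHuveneers2015, §5.6] -/
theorem InClass.exists_bound_ev (h : F.InClass p) :
    ∃ C : ℝ, ∃ M : ℕ, 0 ≤ C ∧ ∀ δ : ℝ, 0 < δ → δ ≤ 1 → ∀ z : PhaseSpace m, |TrigPoly.ev F δ z| ≤ C / δ ^ p * (1 + ‖z.2‖) ^ M := by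
  induction F with
  | nil => exact ⟨0, 0, le_rfl, fun δ _ _ z => by simp [TrigPoly.ev_nil]⟩
  | cons t F ih =>
    obtain ⟨C₁, M₁, hC₁, h₁⟩ := (h t (by simp)).exists_bound_ev
    obtain ⟨C₂, M₂, hC₂, h₂⟩ := ih fun s hs => h s (by simp [hs])
    refine ⟨C₁ + C₂, max M₁ M₂, by positivity, fun δ hδ hδ1 z => ?_⟩
    rw [TrigPoly.ev_cons]
    have hW1 : (1 + ‖z.2‖) ^ M₁ ≤ (1 + ‖z.2‖) ^ max M₁ M₂ := weight_pow_mono z.2 (le_max_left _ _)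
    have hW2 : (1 + ‖z.2‖) ^ M₂ ≤ (1 + ‖z.2‖) ^ max M₁ M₂ := weight_pow_mono z.2 (le_max_right _ _)
    calc |t.ev δ z + TrigPoly.ev F δ z| ≤ |t.ev δ z| + |TrigPoly.ev F δ z| := abs_add_le _ _
      _ ≤ C₁ / δ ^ p * (1 + ‖z.2‖) ^ M₁ + C₂ / δ ^ p * (1 + ‖z.2‖) ^ M₂ := add_le_add (h₁ δ hδ hδ1 z) (h₂ δ hδ hδ1 z)
      _ ≤ C₁ / δ ^ p * (1 + ‖z.2‖) ^ max M₁ M₂ + C₂ / δ ^ p * (1 + ‖z.2‖) ^ max M₁ M₂ := by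
          gcongr
      _ = (C₁ + C₂) / δ ^ p * (1 + ‖z.2‖) ^ max M₁ M₂ := by ring

/-- **`∂_{q_x}` of a polynomial of class `p` with modes `|k|_∞ ≤ B` is `O(δ^{-p} W^M)`.** [cite: DeRoeckHuveneers2015, §5.6] -/
theorem InClass.exists_bound_partialQ (h : F.InClass p) {B : ℕ} (hB : F.ModeBound B) :
    ∃ C : ℝ, ∃ M : ℕ, 0 ≤ C ∧ ∀ δ : ℝ, 0 < δ → δ ≤ 1 → ∀ (x : Fin m) (z : PhaseSpace m),
      |partialQ x (TrigPoly.ev F δ) z| ≤ C / δ ^ p * (1 + ‖z.2‖) ^ M := by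
  induction F with
  | nil =>
    refine ⟨0, 0, le_rfl, fun δ _ _ x z => ?_⟩
    have e : TrigPoly.ev ([] : TrigPoly m) δ = fun _ => (0 : ℝ) := funext fun z => TrigPoly.ev_nil δ z
    rw [e, partialQ_const]; simp
  | cons t F ih =>
    obtain ⟨C₁, M₁, hC₁, h₁⟩ := (h t (by simp)).exists_bound_partialQ (hB t (by simp))
    obtain ⟨C₂, M₂, hC₂, h₂⟩ := ih (fun s hs => h s (by simp [hs])) fun s hs => hB s (by simp [hs])
    refine ⟨C₁ + C₂, max M₁ M₂, by positivity, fun δ hδ hδ1 x z => ?_⟩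
    have hsm : TrigPoly.SmoothAt (t :: F) δ := h.smoothAt hδ hδ1
    rw [TrigPoly.partialQ_ev _ x z fun s hs => (hsm s hs).differentiable, List.map_cons, List.sum_cons,
      ← TrigPoly.partialQ_ev F x z fun s hs => (hsm s (by simp [hs])).differentiable]
    have hW1 : (1 + ‖z.2‖) ^ M₁ ≤ (1 + ‖z.2‖) ^ max M₁ M₂ := weight_pow_mono z.2 (le_max_left _ _)
    have hW2 : (1 + ‖z.2‖) ^ M₂ ≤ (1 + ‖z.2‖) ^ max M₁ M₂ := weight_pow_mono z.2 (le_max_right _ _)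
    calc |partialQ x (t.ev δ) z + partialQ x (TrigPoly.ev F δ) z|
        ≤ |partialQ x (t.ev δ) z| + |partialQ x (TrigPoly.ev F δ) z| := abs_add_le _ _
      _ ≤ C₁ / δ ^ p * (1 + ‖z.2‖) ^ M₁ + C₂ / δ ^ p * (1 + ‖z.2‖) ^ M₂ := add_le_add (h₁ δ hδ hδ1 x z) (h₂ δ hδ hδ1 x z)
      _ ≤ C₁ / δ ^ p * (1 + ‖z.2‖) ^ max M₁ M₂ + C₂ / δ ^ p * (1 + ‖z.2‖) ^ max M₁ M₂ := by
          gcongr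
      _ = (C₁ + C₂) / δ ^ p * (1 + ‖z.2‖) ^ max M₁ M₂ := by ring

/-- **`∂_{ω_x}` of a polynomial of class `p` is `O(δ^{-(p+1)} W^M)`.** [cite: DeRoeckHuveneers2015, §5.6] -/
theorem InClass.exists_bound_partialP (h : F.InClass p) :
    ∃ C : ℝ, ∃ M : ℕ, 0 ≤ C ∧ ∀ δ : ℝ, 0 < δ → δ ≤ 1 → ∀ (x : Fin m) (z : PhaseSpace m),
      |partialP x (TrigPoly.ev F δ) z| ≤ C / δ ^ (p + 1) * (1 + ‖z.2‖) ^ M := by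
  induction F with
  | nil =>
    refine ⟨0, 0, le_rfl, fun δ _ _ x z => ?_⟩
    have e : TrigPoly.ev ([] : TrigPoly m) δ = fun _ => (0 : ℝ) := funext fun z => TrigPoly.ev_nil δ z
    rw [e, partialP_const]; simp
  | cons t F ih =>
    obtain ⟨C₁, M₁, hC₁, h₁⟩ := (h t (by simp)).exists_bound_partialP
    obtain ⟨C₂, M₂, hC₂, h₂⟩ := ih fun s hs => h s (by simp [hs])
    refine ⟨C₁ + C₂, max M₁ M₂, by positivity, fun δ hδ hδ1 x z => ?_⟩
    have hsm : TrigPoly.SmoothAt (t :: F) δ := h.smoothAt hδ hδ1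
    rw [TrigPoly.partialP_ev _ x z fun s hs => (hsm s hs).differentiable, List.map_cons, List.sum_cons,
      ← TrigPoly.partialP_ev F x z fun s hs => (hsm s (by simp [hs])).differentiable]
    have hW1 : (1 + ‖z.2‖) ^ M₁ ≤ (1 + ‖z.2‖) ^ max M₁ M₂ := weight_pow_mono z.2 (le_max_left _ _)
    have hW2 : (1 + ‖z.2‖) ^ M₂ ≤ (1 + ‖z.2‖) ^ max M₁ M₂ := weight_pow_mono z.2 (le_max_right _ _)
    calc |partialP x (t.ev δ) z + partialP x (TrigPoly.ev F δ) z|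
        ≤ |partialP x (t.ev δ) z| + |partialP x (TrigPoly.ev F δ) z| := abs_add_le _ _
      _ ≤ C₁ / δ ^ (p + 1) * (1 + ‖z.2‖) ^ M₁ + C₂ / δ ^ (p + 1) * (1 + ‖z.2‖) ^ M₂ :=
          add_le_add (h₁ δ hδ hδ1 x z) (h₂ δ hδ hδ1 x z)
      _ ≤ C₁ / δ ^ (p + 1) * (1 + ‖z.2‖) ^ max M₁ M₂ + C₂ / δ ^ (p + 1) * (1 + ‖z.2‖) ^ max M₁ M₂ := by
          gcongr
      _ = (C₁ + C₂) / δ ^ (p + 1) * (1 + ‖z.2‖) ^ max M₁ M₂ := by ring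

end TrigPoly

end Literature.MathematicalPhysics.KineticTheory.HeatConduction

end
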